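import Summits.BirchSwinnertonDyer.BirchSwinnertonDyer.Theses.SignedLowerHalves
import Literature.NumberTheory.EllipticCurves.Rank1Residual.Typed.X7
import Literature.NumberTheory.EllipticCurves.Isogeny
import Summits.BirchSwinnertonDyer.Rank1Residual.Supersingular.KobayashiMainConjecture
import Summits.BirchSwinnertonDyer.Rank1Residual.Supersingular.KobayashiMainConjectureX7
import HarnessLib


/-!
# BC3 birth skeleton — crux `KobayashiMainConjectureSmallImage` (route SignedLowerHalves, rank 4)

The crux is the EQUALITY `char X^ε = (ϖ·L_p^ε)` for one sign on corner X7 at NON-surjective (irreducible,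
non-CM) mod-`p` image. The skeleton splits it into its two halves as they actually differ in status there:

* `stub_lowerSmallImage` — the Eisenstein half (`ϖ·L_p^ε ∣ char X^ε`) at small image: no engine in print at
  non-square-free `N` (BSTW 2024 / Wan 2020 need `N` square-free; Fouquet–Wan Thm 5.1 needs a ramified
  non-split Steinberg prime, which forces surjective image — planner census FW-CENSUS.md: the 133 small-image
  X7 pairs of the window are unramified at every multiplicative prime BY NECESSITY).
* `stub_saturationSmallImage` — the upgrade lower ⇒ equality at small image. Content: Kobayashi 2003 Thm 4.1
  first display (corpus `paper:doi-10-1007-s00222-002-0265-4` p0008; tree fact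
  `Kobayashi2003.thm41_signedCharIdeal_divisibility`, clause `rational`) gives `pⁿ L_p^ε ∈ char X^ε` with NO
  image hypothesis; with the lower half and `ϖ ∈ ℤ_(p)^×` this pins `char X^ε = (p^m ϖ L_p^ε)`, `0 ≤ m ≤ n`, so
  the stub is exactly the μ-statement `μ(X^ε) = μ(L_p^ε)` at small image (integral Kato divisibility is NOT
  available: Kato's (12.5.2) ⟺ `ρ_{E,p^∞}` onto, tree `Kato2004.imageContainsSL2_iff_forall_hasSurjectiveModNGaloisRep`,
  and a normaliser-of-Cartan image has no element `τ` fixing `μ_{p^∞}` with `T/(τ-1)T ≅ ℤ_p`), plus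
  `Λ`-torsion of `X^ε` (Kobayashi Thm 1.2, published).

Shape = the A12-admitted one: the two stubs are the ONLY sorried declarations; `KobayashiMainConjectureSmallImage_of`
concludes the crux BY NAME with no binders. Planner g11, 2026-08-25.
-/

set_option autoImplicit false

namespace Summit.BirchSwinnertonDyer.BirchSwinnertonDyer.Cruxes.KobayashiMainConjectureSmallImage

namespace Birth

open Literature.NumberTheory.EllipticCurves.Rank1Residual

/-- stub (Eisenstein half at small image): corner X7, non-CM, `a_p = 0`, `ρ̄_{E,p}` NOT onto ⇒ the lower
divisibility for one sign. No engine in print (see the module docstring). -/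
theorem stub_lowerSmallImage : ∀ (W : WeierstrassCurve ℚ) [W.IsElliptic] [W.IsGloballyMinimal] (p : ℕ) [Fact p.Prime],
    p ≠ 2 → ClassX7 W p → ¬ W.HasCM → W.frobeniusTrace p = 0 → ¬ Surj W p →
    ∃ ε : ℤˣ, Summit.BirchSwinnertonDyer.Rank1Residual.Supersingular.KobayashiLowerDivisibility W p ε := by
  sorry

/-- stub (saturation at small image): in the same regime, for EVERY sign, the lower divisibility upgrades to
Kobayashi's main conjecture — i.e. `μ(X^ε) = μ(L_p^ε)` given Kobayashi Thm 4.1's rational bound `pⁿ L_p^ε ∈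
char X^ε`, Thm 1.2 (torsion) and `ϖ ∈ ℤ_(p)^×`. -/
theorem stub_saturationSmallImage : ∀ (W : WeierstrassCurve ℚ) [W.IsElliptic] [W.IsGloballyMinimal] (p : ℕ) [Fact p.Prime],
    p ≠ 2 → ClassX7 W p → ¬ W.HasCM → W.frobeniusTrace p = 0 → ¬ Surj W p →
    ∀ ε : ℤˣ, Summit.BirchSwinnertonDyer.Rank1Residual.Supersingular.KobayashiLowerDivisibility W p ε →
      Summit.BirchSwinnertonDyer.Rank1Residual.Supersingular.KobayashiMainConjecture W p ε := by
  sorry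

/-- composition = THE SKELETON: the crux BY NAME from exactly the two registered stubs (a sign from the
Eisenstein half, upgraded by saturation); kernel-checked, no sorry of its own. -/
theorem KobayashiMainConjectureSmallImage_of :
    Summit.BirchSwinnertonDyer.BirchSwinnertonDyer.Theses.SignedLowerHalves.KobayashiMainConjectureSmallImage := by
  intro W _ _ p _ hp hX hcm hap hs
  obtain ⟨ε, hε⟩ := stub_lowerSmallImage W p hp hX hcm hap hs
  exact ⟨ε, stub_saturationSmallImage W p hp hX hcm hap hs ε hε⟩

end Birth

end Summit.BirchSwinnertonDyer.BirchSwinnertonDyer.Cruxes.KobayashiMainConjectureSmallImage
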